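import Summits.CriticalPhenomena.Ising3D.Control2DSpectralDensityAsymptotics
import Summits.CriticalPhenomena.Ising3D.Control2DZeroDimension
import Mathlib.Analysis.SpecialFunctions.Log.Basic
import Mathlib.Analysis.SpecialFunctions.Pow.Real
import Mathlib.Tactic.Linarith
import Mathlib.Tactic.Positivity
import Mathlib.Tactic.FieldSimp
import Mathlib.Tactic.Ring
import HarnessLib

/-!
# The typed sum rule determines `Δ_σ`; the exponent `2Δ_σ` is READ OFF the weighted diagonal spectrum:
# `log F(E)/log E → 2Δ_σ` for every unitary typed solution
(cell `pub-ising3x`, seat controls-1 gen 45; PAPER §6.2 / Appendix E — CONTROL-ONLY; sequel to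
`Control2DSpectralDensityAsymptotics`)

HONEST FRAMING: lottery ticket; floor = tightest certified 3D Ising CFT bounds; no exact-solution
claim without a proof. CONTROL-ONLY (`d = 2`, global `sl(2) × sl(2)` blocks, `Δ_σ = s` an INPUT, axiom set
`A2D′`); nothing here is about `d = 3`, no certificate, functional or number of the record is touched, and no
new hypothesis, definition or named fact enters (proof-only).

WHAT THIS FILE ADDS. Two structural facts about the typed class `CrossingData.SatisfiesCrossing s` (`Control2DBootstrap`):

* `nine_rpow_mul_fourPoint_quarter`, **`CrossingData.satisfiesCrossing_unique (hU) (hC : SatisfiesCrossing s)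
  (hC' : SatisfiesCrossing s') (hs : 0 < s) (hs' : 0 < s') : s = s'`** — a unitary datum solves the typed `⟨σσσσ⟩` sum rule
  for AT MOST ONE external dimension `Δ_σ > 0`: crossing symmetry of its four-point function at the diagonal point `x = 1/4`
  (`fourPoint_crossing_free`, `Control2DOpeConvergenceFree`, E.1m — the typed `HasSum` identity summed under the OPE
  convergence it implies) reads `(9/16)^s G(¼,¼) = (1/16)^s G(¾,¾)`, so `9^s = G(¾,¾)/G(¼,¼)` with `G(¼,¼) ≥ 1 > 0`
  (`one_le_fourPoint`, `Control2DFourPoint`: unitarity + block non-negativity), and `s ↦ 9^s` is injective; elementary.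
  `satisfiesCrossing_unique_of_nonneg` adds the edge on the same binders with `0 ≤ s, 0 ≤ s'`: `s = 0` and `s' > 0` are
  incompatible (at `s = 0` every weighted label has `Δ = 0`, `satisfiesCrossing_zero_iff`, `Control2DZeroDimension`, E.1q;
  at `s' > 0` there are non-zero OPE coefficients above every dimension, `infinite_above_free`,
  `Control2DUnboundedSpectrumFree`, E.1l).
* `one_le_spectralCount`; **`CrossingData.tendsto_log_spectralCount_sub`** (`log F(E) - 2s·log E → log((1 + 2P₀)/Γ(2s+1))`) and
  **`tendsto_log_spectralCount_div_log (hU) (hC) (hs : 0 < s) : log F(E)/log E → 2s`** as `E → ∞`, `F = spectralCount` the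
  integrated weighted spectral density of the diagonal expansion (`Control2DDiagonalStates`, PRER 2012 (4.8)): the logarithm
  and the EXPONENT of the Tauberian asymptotics `F(E)/E^{2s} → (1 + 2P₀)/Γ(2s+1)` of `Control2DSpectralDensityAsymptotics`
  (E.1u; the constant is `> 0` because `P₀ ≥ 0`) — the external dimension is recoverable from the growth of the weighted diagonal
  spectrum of any single unitary typed solution; `tendsto_spectralCount_atTop` (`F(E) → ∞`); `record_log_spectralCount (w)`:
  at `Δ_σ = 1/8` on the record's class (binders of `record_spectralCount`), `log F(E) - ¼·log E → log(1/Γ(5/4))`,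
  `log F(E)/log E → 1/4`, and no other `s ≥ 0` solves the typed sum rule for that datum.

NOT claimed: any rate or error term in the logarithmic readout; anything at `s = 0` beyond `satisfiesCrossing_unique_of_nonneg`
(`Control2DZeroDimension`, E.1q, owns that edge) and anything for `s < 0`; uniqueness of the DATUM given `s` (only of `s` given
the datum); anything off the REAL diagonal; Virasoro; anything three-dimensional; any bound on a gap, on `c` or on `λ²`; no
number of the record touched.

References: R. Rattazzi, V. S. Rychkov, E. Tonni, A. Vichi, JHEP 12 (2008) 031, §3 eq. (3.3) (crossing `v^Δ G(u,v) = u^Δ G(v,u)`)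
[cite: RattazziEtAl2008, §3]; D. Pappadopulo, S. Rychkov, J. Espin, R. Rattazzi, Phys. Rev. D 86 (2012) 105043, §4.2 eq. (4.8)–(4.9)
[cite: PappadopuloRychkovEspinRattazzi2012PRD, §4.2]. Tree: `fourPoint_crossing_free` (`Control2DOpeConvergenceFree`);
`one_le_fourPoint` (`Control2DFourPoint`); `infinite_above_free` (`Control2DUnboundedSpectrumFree`); `satisfiesCrossing_zero_iff`
(`Control2DZeroDimension`); `spectralCount`, `diagWeight_nonneg` (`Control2DDiagonalStates`); `tendsto_spectralCount_div_rpow`,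
`record_spectralCount` (`Control2DSpectralDensityAsymptotics`); `twoSided_2d_kernel099` (the record, through `record_spectralCount`).
Mathlib: `Real.rpow_le_rpow_left_iff`, `Real.mul_rpow`, `Real.log_div`, `Real.log_rpow`, `Real.tendsto_log_atTop`,
`Real.continuousAt_log`, `Filter.Tendsto.div_atTop`, `Filter.Tendsto.pos_mul_atTop`.
-/

namespace Summit.CriticalPhenomena.Ising3D.Control2D

open Set Filter Topology
open Literature.MathematicalPhysics.QuantumFieldTheory.ConformalBootstrap3D

namespace CrossingData

variable {D : CrossingData} {s s' : ℝ}

/-! ### The external dimension is determined by the datum -/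

/-- Crossing at the diagonal point `x = 1/4` pins `9^s`: for every unitary solution of the typed sum rule at `s > 0`,
`9^s · G(¼,¼) = G(¾,¾)` (`(9/16)^s G(¼,¼) = (1/16)^s G(¾,¾)`, `fourPoint_crossing_free`). [cite: RattazziEtAl2008, §3 eq. (3.3)] -/
theorem nine_rpow_mul_fourPoint_quarter (hU : D.IsUnitary) (hC : D.SatisfiesCrossing s) (hs : 0 < s) :
    (9 : ℝ) ^ s * D.fourPoint (1 / 4) (1 / 4) = D.fourPoint (3 / 4) (3 / 4) := by
  have hq : (1 / 4 : ℝ) ∈ Ioo (0 : ℝ) 1 := ⟨by norm_num, by norm_num⟩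
  have h := fourPoint_crossing_free hU hC hs hq hq
  have e1 : (1 - (1 / 4 : ℝ)) = 3 / 4 := by norm_num
  rw [e1] at h
  -- `((3/4)(3/4))^s = 9^s (1/16)^s`, `((1/4)(1/4))^s = (1/16)^s`
  have h16 : (0 : ℝ) < (1 / 16 : ℝ) ^ s := Real.rpow_pos_of_pos (by norm_num) s
  have e2 : ((3 / 4 : ℝ) * (3 / 4)) ^ s = (9 : ℝ) ^ s * (1 / 16 : ℝ) ^ s := by
    rw [← Real.mul_rpow (by norm_num) (by norm_num)]; norm_num
  have e3 : ((1 / 4 : ℝ) * (1 / 4)) ^ s = (1 / 16 : ℝ) ^ s := by norm_num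
  rw [e2, e3] at h
  -- cancel `(1/16)^s > 0`
  have h' : (1 / 16 : ℝ) ^ s * ((9 : ℝ) ^ s * D.fourPoint (1 / 4) (1 / 4)) =
      (1 / 16 : ℝ) ^ s * D.fourPoint (3 / 4) (3 / 4) := by
    rw [← h]; ring
  exact mul_left_cancel₀ h16.ne' h'

/-- **A unitary datum solves the typed `⟨σσσσ⟩` sum rule for at most one external dimension `Δ_σ > 0`.** If `D` is unitary
and satisfies crossing at `s > 0` and at `s' > 0` then `s = s'` (`9^s = G(¾,¾)/G(¼,¼) = 9^{s'}` with `G(¼,¼) ≥ 1`).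
[cite: RattazziEtAl2008, §3 eq. (3.3)] -/
theorem satisfiesCrossing_unique (hU : D.IsUnitary) (hC : D.SatisfiesCrossing s) (hC' : D.SatisfiesCrossing s')
    (hs : 0 < s) (hs' : 0 < s') : s = s' := by
  have hq : (1 / 4 : ℝ) ∈ Ioo (0 : ℝ) 1 := ⟨by norm_num, by norm_num⟩
  have hG : 0 < D.fourPoint (1 / 4) (1 / 4) := lt_of_lt_of_le one_pos (one_le_fourPoint hU hq hq)
  have h1 := nine_rpow_mul_fourPoint_quarter hU hC hs
  have h2 := nine_rpow_mul_fourPoint_quarter hU hC' hs'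
  have h9 : (9 : ℝ) ^ s = (9 : ℝ) ^ s' := mul_right_cancel₀ hG.ne' (h1.trans h2.symm)
  have hle : s ≤ s' := (Real.rpow_le_rpow_left_iff (by norm_num : (1 : ℝ) < 9)).mp h9.le
  have hge : s' ≤ s := (Real.rpow_le_rpow_left_iff (by norm_num : (1 : ℝ) < 9)).mp h9.ge
  exact le_antisymm hle hge

/-- **Including the edge `Δ_σ = 0`.** For `s, s' ≥ 0`: a unitary datum solving the typed sum rule at both `s` and `s'` has
`s = s'` — the case `s = 0 < s'` is excluded because at `s = 0` every weighted label has `Δ = 0`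
(`satisfiesCrossing_zero_iff`, E.1q) while at `s' > 0` there are non-zero OPE coefficients above every dimension
(`infinite_above_free`, E.1l). [folklore] -/
theorem satisfiesCrossing_unique_of_nonneg (hU : D.IsUnitary) (hC : D.SatisfiesCrossing s)
    (hC' : D.SatisfiesCrossing s') (hs : 0 ≤ s) (hs' : 0 ≤ s') : s = s' := by
  -- the mixed case: `SatisfiesCrossing 0` and `SatisfiesCrossing t` with `t > 0` is impossible
  have key : ∀ t : ℝ, 0 < t → D.SatisfiesCrossing 0 → D.SatisfiesCrossing t → False := by
    intro t ht h0 hCt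
    have hzero := (satisfiesCrossing_zero_iff hU).mp h0
    have hinf := infinite_above_free hU hCt ht 0
    have hempty : {i | D.p i ≠ 0 ∧ (0 : ℝ) < D.Δ i} = ∅ := by
      ext i
      simp only [mem_setOf_eq, mem_empty_iff_false, iff_false, not_and, not_lt]
      intro hp
      rw [hzero i hp]
    rw [hempty] at hinf
    exact hinf finite_empty
  rcases hs.lt_or_eq with hs0 | hs0
  · rcases hs'.lt_or_eq with hs0' | hs0'
    · exact satisfiesCrossing_unique hU hC hC' hs0 hs0'
    · exact (key s hs0 (hs0' ▸ hC') hC).elim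
  · rcases hs'.lt_or_eq with hs0' | hs0'
    · exact (key s' hs0' (hs0 ▸ hC) hC').elim
    · rw [← hs0, ← hs0']

/-! ### The exponent of the weighted spectral density reads off `2Δ_σ` -/

/-- `F(E) ≥ 1` for unitary OPE-convergent data (the vacuum's unit weight plus non-negative weights). [folklore] -/
theorem one_le_spectralCount (hU : D.IsUnitary) (E : ℝ) : 1 ≤ D.spectralCount E := by
  have h : 0 ≤ ∑' j : ↥({j : D.ι × ℕ × ℕ | D.diagLevel j ≤ E} : Set (D.ι × ℕ × ℕ)), D.diagWeight j :=
    tsum_nonneg fun j => diagWeight_nonneg hU j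
  unfold spectralCount
  linarith

/-- **`log F(E) - 2s·log E → log((1 + 2P₀)/Γ(2s+1))`**: the logarithm of the Tauberian asymptotics of E.1u
(`Control2DSpectralDensityAsymptotics.tendsto_spectralCount_div_rpow`: `F(E)/E^{2s} → (1 + 2P₀)/Γ(2s+1)`, a POSITIVE constant since
`P₀ = Σ'_{Δ_i = 0} p_i ≥ 0` by unitarity), for every unitary solution of the typed sum rule at `Δ_σ = s > 0` (`Real.log` is continuous at
the constant; `log(F/E^{2s}) = log F - 2s·log E` for `E > 1`, `F ≥ 1`). No step of E.1u is re-proved. [cite: PappadopuloRychkovEspinRattazzi2012PRD, §4.2] -/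
theorem tendsto_log_spectralCount_sub (hU : D.IsUnitary) (hC : D.SatisfiesCrossing s) (hs : 0 < s) :
    Tendsto (fun E : ℝ => Real.log (D.spectralCount E) - 2 * s * Real.log E) atTop
      (𝓝 (Real.log ((1 + 2 * ∑' i : ↥({i : D.ι | D.Δ i = 0} : Set D.ι), D.p i) / Real.Gamma (2 * s + 1)))) := by
  set c : ℝ := (1 + 2 * ∑' i : ↥({i : D.ι | D.Δ i = 0} : Set D.ι), D.p i) / Real.Gamma (2 * s + 1) with hc
  have hP0 : 0 ≤ ∑' i : ↥({i : D.ι | D.Δ i = 0} : Set D.ι), D.p i := tsum_nonneg fun i => (hU i).2.2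
  have hcpos : 0 < c := div_pos (by linarith) (Real.Gamma_pos_of_pos (by linarith))
  have hF := tendsto_spectralCount_div_rpow hU hC hs
  have hlog : Tendsto (fun E : ℝ => Real.log (D.spectralCount E / E ^ (2 * s))) atTop (𝓝 (Real.log c)) :=
    (Real.continuousAt_log hcpos.ne').tendsto.comp hF
  refine hlog.congr' ?_
  filter_upwards [eventually_gt_atTop 1] with E hE
  have hE0 : 0 < E := by linarith
  have hFpos : 0 < D.spectralCount E := lt_of_lt_of_le one_pos (one_le_spectralCount hU E)
  have hEs : 0 < E ^ (2 * s) := Real.rpow_pos_of_pos hE0 _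
  rw [Real.log_div hFpos.ne' hEs.ne', Real.log_rpow hE0]

/-- **`log F(E)/log E → 2Δ_σ`**: the EXPONENT of the Tauberian asymptotics of E.1u is read off the integrated weighted spectral
density of the diagonal expansion of any single unitary typed solution at `Δ_σ = s > 0` (`tendsto_log_spectralCount_sub` divided by
`log E → ∞`). [cite: PappadopuloRychkovEspinRattazzi2012PRD, §4.2] -/
theorem tendsto_log_spectralCount_div_log (hU : D.IsUnitary) (hC : D.SatisfiesCrossing s) (hs : 0 < s) :
    Tendsto (fun E : ℝ => Real.log (D.spectralCount E) / Real.log E) atTop (𝓝 (2 * s)) := by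
  have hdiv : Tendsto (fun E : ℝ => (Real.log (D.spectralCount E) - 2 * s * Real.log E) / Real.log E) atTop (𝓝 0) :=
    (tendsto_log_spectralCount_sub hU hC hs).div_atTop Real.tendsto_log_atTop
  have hsum := hdiv.add_const (2 * s)
  rw [zero_add] at hsum
  refine hsum.congr' ?_
  filter_upwards [eventually_gt_atTop 1] with E hE
  have hlogE : 0 < Real.log E := Real.log_pos hE
  field_simp
  ring

/-- **`F(E) → ∞`**: the integrated weighted spectral density of every unitary typed solution at `s > 0` is unbounded
(`F(E) ∼ c E^{2s}` with `c > 0`). [folklore] -/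
theorem tendsto_spectralCount_atTop (hU : D.IsUnitary) (hC : D.SatisfiesCrossing s) (hs : 0 < s) :
    Tendsto (fun E : ℝ => D.spectralCount E) atTop atTop := by
  set c : ℝ := (1 + 2 * ∑' i : ↥({i : D.ι | D.Δ i = 0} : Set D.ι), D.p i) / Real.Gamma (2 * s + 1) with hc
  have hP0 : 0 ≤ ∑' i : ↥({i : D.ι | D.Δ i = 0} : Set D.ι), D.p i := tsum_nonneg fun i => (hU i).2.2
  have hcpos : 0 < c := div_pos (by linarith) (Real.Gamma_pos_of_pos (by linarith))
  have hF := tendsto_spectralCount_div_rpow hU hC hs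
  have hpow : Tendsto (fun E : ℝ => E ^ (2 * s)) atTop atTop := tendsto_rpow_atTop (by linarith)
  have h := Tendsto.pos_mul_atTop hcpos hF hpow
  refine h.congr' ?_
  filter_upwards [eventually_gt_atTop 0] with E hE
  have hEs : 0 < E ^ (2 * s) := Real.rpow_pos_of_pos hE _
  field_simp

end CrossingData

/-! ### The record's class at `Δ_σ = 1/8` -/

/-- **At `Δ_σ = 1/8`, for every datum of the record's class** (unitary, typed sum rule, spin 2 in `{2} ∪ [3,∞)`, scalars in
`{x} ∪ [2,∞)` with `w ≤ x`, hence all labels `≥ 99/100` by `twoSided_2d_kernel099` and `P₀ = 0`): `log F(E) - (1/4)·log E → log(1/Γ(5/4))`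
(the constant of `record_spectralCount`), `log F(E)/log E → 1/4` (the exponent `2Δ_σ = 1/4` read off the weighted diagonal spectrum), and
the datum solves the typed sum rule at no other `s ≥ 0`. CONTROL-ONLY; no certificate or number of the record is touched. [folklore] -/
theorem record_log_spectralCount (w : ℝ) (D : CrossingData) (hU : D.IsUnitary) (hC : D.SatisfiesCrossing (1 / 8))
    (hT : D.SpinTwoIn ({2} ∪ Ici (2 + 1))) (x : ℝ) (hwx : w ≤ x) (hS : D.ScalarsIn ({x} ∪ Ici 2)) :
    Tendsto (fun E : ℝ => Real.log (D.spectralCount E) - (1 / 4 : ℝ) * Real.log E) atTop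
        (𝓝 (Real.log (1 / Real.Gamma (5 / 4)))) ∧
      Tendsto (fun E : ℝ => Real.log (D.spectralCount E) / Real.log E) atTop (𝓝 (1 / 4)) ∧
      ∀ s : ℝ, 0 ≤ s → D.SatisfiesCrossing s → s = 1 / 8 := by
  refine ⟨?_, ?_, fun s hs hCs => ?_⟩
  · -- the record's class: `F(E)/E^{1/4} → 1/Γ(5/4) > 0`, then `log`
    have hF := record_spectralCount w D hU hC hT x hwx hS
    have hcpos : 0 < 1 / Real.Gamma (5 / 4) := div_pos one_pos (Real.Gamma_pos_of_pos (by norm_num))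
    have hlog : Tendsto (fun E : ℝ => Real.log (D.spectralCount E / E ^ (1 / 4 : ℝ))) atTop
        (𝓝 (Real.log (1 / Real.Gamma (5 / 4)))) := (Real.continuousAt_log hcpos.ne').tendsto.comp hF
    refine hlog.congr' ?_
    filter_upwards [eventually_gt_atTop 1] with E hE
    have hE0 : 0 < E := by linarith
    have hFpos : 0 < D.spectralCount E := lt_of_lt_of_le one_pos (CrossingData.one_le_spectralCount hU E)
    have hEs : 0 < E ^ (1 / 4 : ℝ) := Real.rpow_pos_of_pos hE0 _
    rw [Real.log_div hFpos.ne' hEs.ne', Real.log_rpow hE0]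
  · have h := CrossingData.tendsto_log_spectralCount_div_log hU hC (by norm_num : (0 : ℝ) < 1 / 8)
    have e1 : (2 : ℝ) * (1 / 8) = 1 / 4 := by norm_num
    rw [e1] at h
    exact h
  · exact CrossingData.satisfiesCrossing_unique_of_nonneg hU hCs hC hs (by norm_num)

end Summit.CriticalPhenomena.Ising3D.Control2D
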